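import Mathlib
import Summits.KontsevichZagierPeriods.Zeta5Search.RayC1Periodic
import Summits.KontsevichZagierPeriods.Zeta5Search.PeriodicCellKitLin
import HarnessLib

/-!
# ζ(5) search — PERIODIC CELL KIT II: the ray-C1 region table, typing runs, slot cuts and raw hypotheses (fam-denom g14)

HONEST FRAMING: systematic search; no irrationality claim unless certified.  Integer bookkeeping of net exponents of
the T1 ray C1 (`bRay β1 n`, `d = 64n`) below `θ = 1`; nothing here is an irrationality statement.

Middle layer of the periodic cell kit (`PeriodicCellKitLin` ⊂ this ⊂ `PeriodicCellKit`).  §1 indexes the eighteen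
doubled-position level regions of `RayC1Periodic` (`reg1_low … reg1_high`) as a table with ONE lookup lemma `regFact`;
§2 defines TYPING RUNS (region, base length, slope; optionally a second piece of equal depth) and their run word
`tword`, lists the `levels_run` side conditions of a run list as integer-affine OBLIGATION FORMS `trunObls` in
`(x, n, p, P = t·p)`, and proves `levels_of_truns`: certified obligations ⇒ `Levels (bRay β1 n) x p (rdecode (tword R) t)`
(induction with `levels_run` / `levels_run2` of `ClassTypeGuardsPeriodicI`); §3 defines the four kinds of SLOT CUTS, the
WINDOW CONTEXT of a cell class and the RAW HYPOTHESIS list of a slot with its soundness `rawHyps_hold`.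
-/

open Finset

namespace Summit.KontsevichZagierPeriods.Zeta5Search.CellKit

open Summit.KontsevichZagierPeriods.Zeta5Search.ClusterValuation (netExp)
open Summit.KontsevichZagierPeriods.Zeta5Search.ClassTypeCover
open Summit.KontsevichZagierPeriods.Zeta5Search.T1Rays (bRay β1)

/-! ## §1 The region table of ray C1 (indices 0 … 17: low, d1 … d6, wl, cen, wr, wo, u6 … u1, high) -/

/-- `n`-coefficient of a region's lower end (doubled positions). -/
def lonT : List ℕ := [0, 40, 44, 50, 54, 60, 64, 70, 85, 85, 70, 100, 106, 110, 116, 120, 126, 130]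
/-- constant of a region's lower end. -/
def lo0T : List ℕ := [0, 0, 0, 0, 0, 0, 0, 0, 0, 1, 0, 2, 2, 2, 2, 2, 2, 2]
/-- `n`-coefficient of a region's upper end. -/
def hinT : List ℕ := [40, 44, 50, 54, 60, 64, 70, 85, 85, 100, 100, 106, 110, 116, 120, 126, 130, 170]
/-- constant of a region's upper end. -/
def hi0T : List ℕ := [0, 0, 0, 0, 0, 0, 0, 1, 2, 2, 2, 2, 2, 2, 2, 2, 2, 2]
/-- depth (net exponent) on a region. -/
def rdT : List ℤ := [1, 0, -1, -2, -3, -4, -5, -6, -5, -6, -6, -5, -4, -3, -2, -1, 0, 1]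
/-- table lookups -/
def lon (r : ℕ) : ℕ := lonT.getD r 0
/-- table lookups -/
def lo0 (r : ℕ) : ℕ := lo0T.getD r 0
/-- table lookups -/
def hin (r : ℕ) : ℕ := hinT.getD r 0
/-- table lookups -/
def hi0 (r : ℕ) : ℕ := hi0T.getD r 0
/-- table lookups -/
def rd (r : ℕ) : ℤ := rdT.getD r 0

/-- **The region facts of `RayC1Periodic`, indexed.**  Region 10 (`wo`, the well in one piece) needs `n` odd. -/
theorem regFact (n : ℕ) {a : ℕ} (hpar : n % 2 = a) (r : ℕ) (hr : r < 18) (hwo : r ≠ 10 ∨ a = 1) :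
    ∀ q, lon r * n + lo0 r ≤ 2 * q → 2 * q + 2 ≤ hin r * n + hi0 r → netExp (bRay β1 n) q = rd r := by
  intro q h1 h2
  interval_cases r <;> simp only [lon, lo0, hin, hi0, rd, lonT, lo0T, hinT, hi0T, rdT, List.getD_cons_succ,
    List.getD_cons_zero] at h1 h2 ⊢
  · exact reg1_low n q (by omega) (by omega)
  · exact reg1_d1 n q (by omega) (by omega)
  · exact reg1_d2 n q (by omega) (by omega)
  · exact reg1_d3 n q (by omega) (by omega)
  · exact reg1_d4 n q (by omega) (by omega)
  · exact reg1_d5 n q (by omega) (by omega)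
  · exact reg1_d6 n q (by omega) (by omega)
  · exact reg1_wl n q (by omega) (by omega)
  · exact reg1_cen n q (by omega) (by omega)
  · exact reg1_wr n q (by omega) (by omega)
  · exact reg1_wo n (by omega) q (by omega) (by omega)
  · exact reg1_u6 n q (by omega) (by omega)
  · exact reg1_u5 n q (by omega) (by omega)
  · exact reg1_u4 n q (by omega) (by omega)
  · exact reg1_u3 n q (by omega) (by omega)
  · exact reg1_u2 n q (by omega) (by omega)
  · exact reg1_u1 n q (by omega) (by omega)
  · exact reg1_high n q (by omega) (by omega)

/-! ## §2 Typing runs and their obligations -/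

/-- A TYPING RUN: region `r`, base length `l`, slope `s`; if `two`, a second piece `(r2, l2, s2)` of the same depth
(the well on both sides of the centre) merged into one run of the word (`levels_run2`). -/
structure TRun where
  /-- region index -/
  r : ℕ
  /-- base length -/
  l : ℕ
  /-- slope in `t` -/
  s : ℕ
  /-- two-piece run? -/
  two : Bool
  /-- second region index -/
  r2 : ℕ
  /-- second base length -/
  l2 : ℕ
  /-- second slope -/
  s2 : ℕ
deriving DecidableEq, Repr

/-- The run word of a typing-run list. -/
def tword : List TRun → List Run
  | [] => []
  | tr :: R => (rd tr.r, if tr.two then tr.l + tr.l2 else tr.l, if tr.two then tr.s + tr.s2 else tr.s) :: tword R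

/-- Region indices valid (`wo` only for odd `n`), two-piece runs of equal depth. -/
def trunsOK (a : ℕ) : List TRun → Bool
  | [] => true
  | tr :: R => decide (tr.r < 18) && (decide (tr.r ≠ 10) || decide (a = 1)) &&
      (!tr.two || (decide (tr.r2 < 18) && (decide (tr.r2 ≠ 10) || decide (a = 1)) && decide (rd tr.r2 = rd tr.r))) &&
      trunsOK a R

/-- Obligation form of `lo_r ≤ 2(x + K p + S P)`. -/
def h1f (r K S : ℕ) : LinForm := ⟨2, -(lon r : ℤ), 2 * K, 2 * S, -(lo0 r : ℤ)⟩
/-- Obligation form of `2(x + K' p + S' P) + 2 ≤ hi_r + 2p`. -/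
def h2f (r K S : ℕ) : LinForm := ⟨-2, hin r, 2 - 2 * (K : ℤ), -(2 * (S : ℤ)), (hi0 r : ℤ) - 2⟩

/-- The run obligations of a typing-run list started at prefix `(K, S)`. -/
def trunObls : List TRun → ℕ → ℕ → List LinForm
  | [], _, _ => []
  | tr :: R, K, S =>
    if tr.two then
      h1f tr.r K S :: h2f tr.r (K + tr.l) (S + tr.s) :: h1f tr.r2 (K + tr.l) (S + tr.s) ::
        h2f tr.r2 (K + tr.l + tr.l2) (S + tr.s + tr.s2) :: trunObls R (K + (tr.l + tr.l2)) (S + (tr.s + tr.s2))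
    else h1f tr.r K S :: h2f tr.r (K + tr.l) (S + tr.s) :: trunObls R (K + tr.l) (S + tr.s)

variable {n p x t P : ℕ}

/-- Reading the `h1` obligation form back as the `levels_run` hypothesis. -/
theorem h1_of {r K S : ℕ} (e : 0 ≤ (h1f r K S).eval x n p P) : lon r * n + lo0 r ≤ 2 * (x + K * p + S * P) := by
  simp only [h1f, LinForm.eval] at e
  zify; linarith

/-- Reading the `h2` obligation form back as the `levels_run` hypothesis. -/
theorem h2_of {r K S : ℕ} (e : 0 ≤ (h2f r K S).eval x n p P) :
    2 * (x + K * p + S * P) + 2 ≤ hin r * n + hi0 r + 2 * p := by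
  simp only [h2f, LinForm.eval] at e
  zify; linarith

/-- **Levels from certified run obligations** (induction with `levels_run` / `levels_run2`). -/
theorem levels_of_truns (hP : t * p = P) {a : ℕ} (hpar : n % 2 = a) :
    ∀ (R : List TRun) (K S : ℕ), trunsOK a R = true → (∀ f ∈ trunObls R K S, 0 ≤ f.eval x n p P) →
      Levels (bRay β1 n) (x + (K + S * t) * p) p (rdecode (tword R) t)
  | [], K, S, _, _ => levels_run_nil _ x p t K S
  | tr :: R, K, S, hok, hob => by
    obtain ⟨r, l, s, two, r2, l2, s2⟩ := tr
    simp only [trunsOK, Bool.and_eq_true, Bool.or_eq_true, decide_eq_true_eq, Bool.not_eq_true'] at hok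
    obtain ⟨⟨⟨hr, hwo⟩, htwo⟩, hR⟩ := hok
    have hreg := regFact n hpar r hr hwo
    cases two
    · simp only [trunObls, tword, Bool.false_eq_true, if_false] at hob ⊢
      have e1 := hob _ (List.mem_cons_self ..)
      have e2 := hob _ (List.mem_cons_of_mem _ (List.mem_cons_self ..))
      have ih := levels_of_truns hP hpar R (K + l) (S + s) hR
        (fun f hf => hob f (List.mem_cons_of_mem _ (List.mem_cons_of_mem _ hf)))
      exact levels_run hP hreg (h1_of e1) (h2_of e2) ih
    · simp only [trunObls, tword, if_true] at hob ⊢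
      simp only [Bool.true_eq_false, false_or] at htwo
      obtain ⟨⟨hr2, hwo2⟩, hd⟩ := htwo
      have hreg2 := regFact n hpar r2 hr2 hwo2
      rw [hd] at hreg2
      have e1 := hob _ (List.mem_cons_self ..)
      have e2 := hob _ (List.mem_cons_of_mem _ (List.mem_cons_self ..))
      have e3 := hob _ (List.mem_cons_of_mem _ (List.mem_cons_of_mem _ (List.mem_cons_self ..)))
      have e4 := hob _ (List.mem_cons_of_mem _ (List.mem_cons_of_mem _ (List.mem_cons_of_mem _ (List.mem_cons_self ..))))
      have ih := levels_of_truns hP hpar R (K + (l + l2)) (S + (s + s2)) hR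
        (fun f hf => hob f (List.mem_cons_of_mem _ (List.mem_cons_of_mem _ (List.mem_cons_of_mem _
          (List.mem_cons_of_mem _ hf)))))
      have e4' : 2 * (x + (K + l + l2) * p + (S + s + s2) * P) + 2 ≤ hin r2 * n + hi0 r2 + 2 * p := h2_of e4
      exact levels_run2 hP hreg hreg2 (h1_of e1) (h2_of e2) (h1_of e3) e4' ih

/-! ## §3 Slot cuts, window context, raw hypotheses -/

/-- The four kinds of slot cuts of a ray-C1 periodic cell. -/
inductive CutKind
  | L | U | Clo | Chi
deriving DecidableEq, Repr

/-- A slot cut: `x + j0 p + σ P < c n` (`L`), `< c n + 1` (`U`), `2x + j0 p + σ P < 85 n` (`Clo`), `< 85 n + 2` (`Chi`). -/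
structure Cut where
  /-- kind -/
  kind : CutKind
  /-- `n`-coefficient (unused for `Clo`/`Chi`) -/
  c : ℕ
  /-- `p`-coefficient -/
  j0 : ℕ
  /-- `P`-coefficient -/
  σ : ℕ
deriving DecidableEq, Repr

namespace Cut

/-- The cut as a Boolean test. -/
def test (k : Cut) (x n p P : ℕ) : Bool :=
  match k.kind with
  | .L => decide (x + k.j0 * p + k.σ * P < k.c * n)
  | .U => decide (x + k.j0 * p + k.σ * P < k.c * n + 1)
  | .Clo => decide (2 * x + k.j0 * p + k.σ * P < 85 * n)
  | .Chi => decide (2 * x + k.j0 * p + k.σ * P < 85 * n + 2)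

/-- The form that is nonnegative when the cut holds. -/
def pos (k : Cut) : LinForm :=
  match k.kind with
  | .L => ⟨-1, k.c, -(k.j0 : ℤ), -(k.σ : ℤ), -1⟩
  | .U => ⟨-1, k.c, -(k.j0 : ℤ), -(k.σ : ℤ), 0⟩
  | .Clo => ⟨-2, 85, -(k.j0 : ℤ), -(k.σ : ℤ), -1⟩
  | .Chi => ⟨-2, 85, -(k.j0 : ℤ), -(k.σ : ℤ), 1⟩

/-- The form that is nonnegative when the cut fails. -/
def negf (k : Cut) : LinForm :=
  match k.kind with
  | .L => ⟨1, -(k.c : ℤ), k.j0, k.σ, 0⟩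
  | .U => ⟨1, -(k.c : ℤ), k.j0, k.σ, -1⟩
  | .Clo => ⟨2, -85, k.j0, k.σ, 0⟩
  | .Chi => ⟨2, -85, k.j0, k.σ, -2⟩

/-- A passed cut, as a nonnegative affine form. -/
theorem eval_pos {k : Cut} (h : k.test x n p P = true) : 0 ≤ k.pos.eval x n p P := by
  obtain ⟨kind, c, j0, σ⟩ := k
  cases kind <;> simp only [test, decide_eq_true_eq, pos, LinForm.eval, neg_mul] at h ⊢ <;> zify at h <;> omega

/-- A failed cut, as a nonnegative affine form. -/
theorem eval_negf {k : Cut} (h : k.test x n p P = false) : 0 ≤ k.negf.eval x n p P := by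
  obtain ⟨kind, c, j0, σ⟩ := k
  cases kind <;> simp only [test, decide_eq_false_iff_not, negf, LinForm.eval, neg_mul] at h ⊢ <;> zify at h <;> omega

end Cut

/-- WINDOW CONTEXT of a cell class: Farey cell `u1/u2 < y < v1/v2`, residue `b1` of `m` mod 2, parity `a` of `n`,
least admissible prime `pmin`. -/
structure Ctx where
  /-- numerator of `u` -/
  u1 : ℕ
  /-- denominator of `u` -/
  u2 : ℕ
  /-- numerator of `v` -/
  v1 : ℕ
  /-- denominator of `v` -/
  v2 : ℕ
  /-- `m mod 2` representative (1 or 2) -/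
  b1 : ℕ
  /-- `n mod 2` -/
  a : ℕ
  /-- least prime of the window -/
  pmin : ℕ
deriving DecidableEq, Repr

/-- RAW HYPOTHESES of a slot, in this order: `x < p`, `x ≥ 0`, `n ≥ 0`, `P ≥ 0`, `p ≥ pmin`, window sides A, B,
then the failed lower cut (if any), the passed upper cut (if any), and the centre equality as two inequalities (if `cen`). -/
def rawHyps (C : Ctx) (lc hi : Option Cut) (cen : Bool) (L0 S0 : ℕ) : List LinForm :=
  [⟨-1, 0, 1, 0, -1⟩, ⟨1, 0, 0, 0, 0⟩, ⟨0, 1, 0, 0, 0⟩, ⟨0, 0, 0, 1, 0⟩, ⟨0, 0, 1, 0, -(C.pmin : ℤ)⟩,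
    ⟨0, C.u2, -((C.u2 * C.b1 + C.u1 : ℕ) : ℤ), -((2 * C.u2 : ℕ) : ℤ), -1⟩,
    ⟨0, -(C.v2 : ℤ), ((C.v2 * C.b1 + C.v1 : ℕ) : ℤ), ((2 * C.v2 : ℕ) : ℤ), -1⟩] ++
  (match lc with | none => [] | some c => [c.negf]) ++
  (match hi with | none => [] | some c => [c.pos]) ++
  (if cen then [⟨2, -85, L0, S0, 0⟩, ⟨-2, 85, -(L0 : ℤ), -(S0 : ℤ), 0⟩] else [])

/-- The raw hypotheses hold under the slot's Lean hypotheses. -/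
theorem rawHyps_hold (C : Ctx) (lc hi : Option Cut) (cen : Bool) (L0 S0 : ℕ) (hx : x < p) (hp : C.pmin ≤ p)
    (hA : (C.u2 * C.b1 + C.u1) * p + 2 * C.u2 * P < C.u2 * n) (hB : C.v2 * n < (C.v2 * C.b1 + C.v1) * p + 2 * C.v2 * P)
    (hlo : ∀ c, lc = some c → c.test x n p P = false) (hhi : ∀ c, hi = some c → c.test x n p P = true)
    (hcen : cen = true → 2 * x + L0 * p + S0 * P = 85 * n) :
    ∀ h ∈ rawHyps C lc hi cen L0 S0, 0 ≤ h.eval x n p P := by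
  intro h hh
  simp only [rawHyps, List.mem_append, List.mem_cons, List.not_mem_nil, or_false] at hh
  rcases hh with ((hh | hh) | hh) | hh
  · rcases hh with rfl | rfl | rfl | rfl | rfl | rfl | rfl <;> simp only [LinForm.eval]
    · omega
    · omega
    · omega
    · omega
    · omega
    · zify at hA; push_cast; linarith
    · zify at hB; push_cast; linarith
  · cases lc with
    | none => simp at hh
    | some c => simp only [List.mem_singleton] at hh; subst hh; exact Cut.eval_negf (hlo c rfl)
  · cases hi with
    | none => simp at hh
    | some c => simp only [List.mem_singleton] at hh; subst hh; exact Cut.eval_pos (hhi c rfl)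
  · cases cen with
    | false => simp at hh
    | true =>
      have e := hcen rfl
      simp only [if_true, List.mem_cons, List.not_mem_nil, or_false] at hh
      rcases hh with rfl | rfl <;> simp only [LinForm.eval] <;> zify at e <;> linarith

end Summit.KontsevichZagierPeriods.Zeta5Search.CellKit
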